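import Summits.QuantumAdvantage.QuantumAdvantage.Theorems.AnchorDialOrbit

/-!
# LocusDial — part 2 «Rung» (cell decomp-qadv, seat lens-2, generation 16; supports item 26531 `ExactnessDial.PolyLossOddU3`)

§8 of the g16 node «LocusDial», re-namespaced to `…Theorems.LocusDial`; Prop-free.  THE BLIND-PAIRS LAW
`blindPointer_loss`: a pointer `ptr : input → position ≤ N` that is, on the odd class, invariant under four separated
adjacent pair-flips hits a kernel position (`gCond`) on at most `11/16` of the odd class — degree-free and
stability-free (the tree's four-flip orbit `AnchorDial.orb` with the pointer CONSTANT along the orbit while its kernel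
phase walks by nonzero steps, `cN_orb`; the 16-point core `core16` by kernel `decide`).  Also the `𝔽₃`-linear hash
`linHash` of the input bits, its invariance under an unread pair-flip, and the corollary `blindHashPointer_loss` for
every affinely hashed pointer whose hash leaves four separated adjacent pairs unread (every lookup `π`, every `t`).
No `sorry`; standard axioms.
-/

set_option linter.dupNamespace false

noncomputable section

open scoped Classical

namespace Summit.QuantumAdvantage.QuantumAdvantage.Theorems.LocusDial

open Finset
open Summit.QuantumAdvantage.AdviceFreeQNC0
open Summit.QuantumAdvantage.QuantumAdvantage.Theorems.HolonomyDial (gCond card_odd_le)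
open Summit.QuantumAdvantage.QuantumAdvantage.Theorems.AnchorDial (flip2 flip2_apply_of_ne cN gCond_iff_cN fz fz_apply
  oddZeros_fz sh orb cN_orb oddZeros_orb orb_orb card_filter_orb card_B4)
open Summit.QuantumAdvantage.QuantumAdvantage.Theorems.AnchorDial.Core (B4)

variable {N : ℕ}

/-! ## The `𝔽₃`-linear hash -/

/-- an `𝔽₃`-LINEAR HASH of the input bits: `L_s(x) = Σ_i M_{s,i}·[x_i]`, `s < t`. -/
def linHash {t : ℕ} (M : Fin t → Fin N → ZMod 3) (x : Fin N → Bool) : Fin t → ZMod 3 :=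
  fun s => ∑ i : Fin N, M s i * (if x i then 1 else 0)


/-! ## §8  The RUNG (PROVED): a pointer BLIND TO FOUR ADJACENT PAIRS misses the kernel on `≥ 5/16` of the odd class
(degree-free, stability-free; the tree's four-flip orbit `AnchorDial.orb` with the pointer CONSTANT along the orbit) -/

/-- the finite core: whatever the hidden trit `c` and the four shift signs, at most `11` of the `16` orbit points carry a
kernel phase `≢ 2` — because each optional flip shifts the phase by a NONZERO amount. -/
theorem core16 : ∀ c : ℕ, c < 3 → ∀ p₁ z₁ p₂ z₂ p₃ z₃ p₄ z₄ : Bool,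
    (univ.filter fun ε : B4 =>
      (c + sh ε.1 p₁ z₁ + sh ε.2.1 p₂ z₂ + sh ε.2.2.1 p₃ z₃ + sh ε.2.2.2 p₄ z₄) % 3 ≠ 2).card ≤ 11 := by
  decide

/-- **BLIND-PAIRS LAW** (the g16 rung).  Four flip sites `b₁ < b₂ < b₃ < b₄` (gaps `≥ 2`, `b₄ + 3 ≤ N`) and a POINTER
`ptr : input ↦ position ≤ N` that is, on the odd class, INVARIANT under each of the four adjacent pair-flips
`(b_i, b_i + 1)` — e.g. any function of the other `N - 8` bits, any hash that does not read those pairs; no degree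
bound, no stability on average, no declaration.  Then the pointer hits a kernel position on at most `11/16` of the odd
class: along the `16`-point orbit the pointer stands still while its kernel phase moves by `Σ_i ε_i σ_i` with all
`σ_i ≠ 0` (`cN_orb`), and such a walk visits the losing residue at `≥ 5` of the `16` points (`core16`). -/
theorem blindPointer_loss {b₁ b₂ b₃ b₄ : ℕ} (h12 : b₁ + 2 ≤ b₂) (h23 : b₂ + 2 ≤ b₃) (h34 : b₃ + 2 ≤ b₄)
    (h4N : b₄ + 3 ≤ N) (ptr : (Fin N → Bool) → ℕ) (hptr : ∀ x, ptr x ≤ N)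
    (hinv₁ : ∀ x, OddZeros x → ptr (flip2 b₁ (b₁ + 1) x) = ptr x)
    (hinv₂ : ∀ x, OddZeros x → ptr (flip2 b₂ (b₂ + 1) x) = ptr x)
    (hinv₃ : ∀ x, OddZeros x → ptr (flip2 b₃ (b₃ + 1) x) = ptr x)
    (hinv₄ : ∀ x, OddZeros x → ptr (flip2 b₄ (b₄ + 1) x) = ptr x) :
    16 * (univ.filter fun x : Fin N → Bool => OddZeros x ∧ gCond x (ptr x)).card ≤ 11 * 2 ^ (N - 1) := by
  -- the pointer is constant along every orbit of an odd input
  have hinv : ∀ (ε : B4) (x : Fin N → Bool), OddZeros x → ptr (orb b₁ b₂ b₃ b₄ ε x) = ptr x := by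
    rintro ⟨e₁, e₂, e₃, e₄⟩ x hx
    have hx4 : OddZeros (fz e₄ b₄ x) := (oddZeros_fz e₄ (by omega) x).2 hx
    have hx3 : OddZeros (fz e₃ b₃ (fz e₄ b₄ x)) := (oddZeros_fz e₃ (by omega) _).2 hx4
    have hx2 : OddZeros (fz e₂ b₂ (fz e₃ b₃ (fz e₄ b₄ x))) := (oddZeros_fz e₂ (by omega) _).2 hx3
    have i4 : ptr (fz e₄ b₄ x) = ptr x := by
      cases e₄
      · rfl
      · exact hinv₄ x hx
    have i3 : ptr (fz e₃ b₃ (fz e₄ b₄ x)) = ptr (fz e₄ b₄ x) := by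
      cases e₃
      · rfl
      · exact hinv₃ _ hx4
    have i2 : ptr (fz e₂ b₂ (fz e₃ b₃ (fz e₄ b₄ x))) = ptr (fz e₃ b₃ (fz e₄ b₄ x)) := by
      cases e₂
      · rfl
      · exact hinv₂ _ hx3
    have i1 : ptr (fz e₁ b₁ (fz e₂ b₂ (fz e₃ b₃ (fz e₄ b₄ x)))) = ptr (fz e₂ b₂ (fz e₃ b₃ (fz e₄ b₄ x))) := by
      cases e₁
      · rfl
      · exact hinv₁ _ hx2
    show ptr (fz e₁ b₁ (fz e₂ b₂ (fz e₃ b₃ (fz e₄ b₄ x)))) = ptr x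
    rw [i1, i2, i3, i4]
  -- (1) every orbit map preserves the number of odd winners
  have hcount : ∀ ε : B4, (univ.filter fun x : Fin N → Bool =>
      OddZeros x ∧ gCond (orb b₁ b₂ b₃ b₄ ε x) (ptr x)).card =
      (univ.filter fun x : Fin N → Bool => OddZeros x ∧ gCond x (ptr x)).card := by
    intro ε
    rw [← card_filter_orb b₁ b₂ b₃ b₄ ε (fun y => OddZeros y ∧ gCond y (ptr y))]
    refine congrArg _ (filter_congr fun x _ => ?_)
    rw [oddZeros_orb (by omega) (by omega) (by omega) (by omega)]
    exact ⟨fun ⟨hx, hg⟩ => ⟨hx, by rwa [hinv ε x hx]⟩, fun ⟨hx, hg⟩ => ⟨hx, by rwa [hinv ε x hx] at hg⟩⟩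
  -- (2) per odd input at most 11 of the 16 orbit points win
  have h11 : ∀ x, OddZeros x →
      (univ.filter fun ε : B4 => gCond (orb b₁ b₂ b₃ b₄ ε x) (ptr x)).card ≤ 11 := by
    intro x _
    have e : (univ.filter fun ε : B4 => gCond (orb b₁ b₂ b₃ b₄ ε x) (ptr x)) =
        univ.filter fun ε : B4 => (cN x (ptr x) % 3 + sh ε.1 (decide (b₁ + 1 ≤ ptr x)) (zpar x (b₁ + 1))
          + sh ε.2.1 (decide (b₂ + 1 ≤ ptr x)) (zpar x (b₂ + 1))
          + sh ε.2.2.1 (decide (b₃ + 1 ≤ ptr x)) (zpar x (b₃ + 1))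
          + sh ε.2.2.2 (decide (b₄ + 1 ≤ ptr x)) (zpar x (b₄ + 1))) % 3 ≠ 2 := by
      refine filter_congr fun ε _ => ?_
      rw [gCond_iff_cN, cN_orb x h12 h23 h34 h4N ε (ptr x) (hptr x)]
      constructor <;> intro h <;> omega
    rw [e]
    exact core16 _ (Nat.mod_lt _ (by norm_num)) _ _ _ _ _ _ _ _
  -- (3) double counting over (orbit point, input)
  have hdc : ∑ ε : B4, (univ.filter fun x : Fin N → Bool =>
        OddZeros x ∧ gCond (orb b₁ b₂ b₃ b₄ ε x) (ptr x)).card =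
      ∑ x ∈ univ.filter (fun x : Fin N → Bool => OddZeros x),
        (univ.filter fun ε : B4 => gCond (orb b₁ b₂ b₃ b₄ ε x) (ptr x)).card := by
    simp_rw [card_filter]
    rw [sum_comm, sum_filter]
    refine sum_congr rfl fun x _ => ?_
    by_cases hx : OddZeros x
    · rw [if_pos hx]
      exact sum_congr rfl fun ε _ => by simp only [hx, true_and]
    · rw [if_neg hx]
      exact sum_eq_zero fun ε _ => by simp only [hx, false_and, if_false]
  have hsum : ∑ ε : B4, (univ.filter fun x : Fin N → Bool =>
        OddZeros x ∧ gCond (orb b₁ b₂ b₃ b₄ ε x) (ptr x)).card =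
      16 * (univ.filter fun x : Fin N → Bool => OddZeros x ∧ gCond x (ptr x)).card := by
    simp_rw [hcount]
    rw [sum_const, card_univ, card_B4, smul_eq_mul]
  have hbound : ∑ x ∈ univ.filter (fun x : Fin N → Bool => OddZeros x),
      (univ.filter fun ε : B4 => gCond (orb b₁ b₂ b₃ b₄ ε x) (ptr x)).card ≤
      11 * (univ.filter fun x : Fin N → Bool => OddZeros x).card := by
    rw [mul_comm, ← smul_eq_mul, ← sum_const]
    exact sum_le_sum fun x hx => h11 x (mem_filter.1 hx).2
  have hO := card_odd_le (n := N) (by omega)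
  calc 16 * (univ.filter fun x : Fin N → Bool => OddZeros x ∧ gCond x (ptr x)).card
      = ∑ x ∈ univ.filter (fun x : Fin N → Bool => OddZeros x),
          (univ.filter fun ε : B4 => gCond (orb b₁ b₂ b₃ b₄ ε x) (ptr x)).card := by rw [← hsum, hdc]
    _ ≤ 11 * (univ.filter fun x : Fin N → Bool => OddZeros x).card := hbound
    _ ≤ 11 * 2 ^ (N - 1) := Nat.mul_le_mul_left _ hO

/-- a linear hash that does NOT READ positions `a, a+1` is invariant under the pair-flip there. -/
theorem linHash_flip2_of_unread {t : ℕ} (M : Fin t → Fin N → ZMod 3) {a : ℕ}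
    (ha : ∀ s (i : Fin N), i.val = a ∨ i.val = a + 1 → M s i = 0) (x : Fin N → Bool) :
    linHash M (flip2 a (a + 1) x) = linHash M x := by
  funext s
  unfold linHash
  refine sum_congr rfl fun i _ => ?_
  by_cases hi : i.val = a ∨ i.val = a + 1
  · rw [ha s i hi, zero_mul, zero_mul]
  · rw [not_or] at hi
    rw [flip2_apply_of_ne x hi.1 hi.2]

/-- **BLIND HASHED POINTER** (the rung in the currency of `AffinePointerLoss3`): an affinely hashed pointer whose hash
leaves four separated adjacent pairs UNREAD hits the kernel on at most `11/16` of the odd class — for every `t`, every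
such `M` and EVERY lookup `π`.  Outside the known regime of `T` (the pointer is a generic function of `N - 8` bits:
not local, not a junta, not flip-stable) and exercising exactly the lever of `U` (location-free confinement). -/
theorem blindHashPointer_loss {t : ℕ} (M : Fin t → Fin N → ZMod 3) (π : (Fin t → ZMod 3) → Fin N)
    {b₁ b₂ b₃ b₄ : ℕ} (h12 : b₁ + 2 ≤ b₂) (h23 : b₂ + 2 ≤ b₃) (h34 : b₃ + 2 ≤ b₄) (h4N : b₄ + 3 ≤ N)
    (hu₁ : ∀ s (i : Fin N), i.val = b₁ ∨ i.val = b₁ + 1 → M s i = 0)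
    (hu₂ : ∀ s (i : Fin N), i.val = b₂ ∨ i.val = b₂ + 1 → M s i = 0)
    (hu₃ : ∀ s (i : Fin N), i.val = b₃ ∨ i.val = b₃ + 1 → M s i = 0)
    (hu₄ : ∀ s (i : Fin N), i.val = b₄ ∨ i.val = b₄ + 1 → M s i = 0) :
    16 * (univ.filter fun x : Fin N → Bool => OddZeros x ∧ gCond x (π (linHash M x)).val).card ≤
      11 * 2 ^ (N - 1) :=
  blindPointer_loss h12 h23 h34 h4N (fun x => (π (linHash M x)).val) (fun x => (π (linHash M x)).isLt.le)
    (fun x _ => by simp only [linHash_flip2_of_unread M hu₁])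
    (fun x _ => by simp only [linHash_flip2_of_unread M hu₂])
    (fun x _ => by simp only [linHash_flip2_of_unread M hu₃])
    (fun x _ => by simp only [linHash_flip2_of_unread M hu₄])


end Summit.QuantumAdvantage.QuantumAdvantage.Theorems.LocusDial

end
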